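import Mathlib
import Summits.Ventures.PercRepro2.HCov
import Summits.Ventures.PercRepro2.GcInterior
import Summits.Ventures.PercRepro2.GcInteriorPos
import Summits.Ventures.PercRepro2.GcSkelMarksConn
import Summits.Ventures.PercRepro2.GcSkelTwoConnected
import Summits.Ventures.PercRepro2.GcSkelReductionMinH

/-!
# `D_o > 0` on the residual at interior weights (blind cell PercRepro2, typer-1 g55)

`D_o = P(PD, o ∈ U)` is the numerator of `γ = D_o / D`. It is positive at interior weights as
soon as `o` reaches a root in `G − {the other root, a₃}`, and on the weighted residual that is
always the case: with `K` the component of `o` in `G − {a₁, a₂, a₃}`, either an edge joins `K`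
to a root — then `o` reaches that root in `G` minus the other two marks — or `K` is closed under
the open adjacency of `G − a₃`, against `o ↔ a₁` there (two-connectivity off `a₃`):

* `sepConfig_mono` (fewer separated vertices, more open edges), `eq_of_conn_sepConfig_of_mem`
  (a separated vertex is isolated), `conn_sepConfig_pair_of_edge` (the edge step);
* **`conn_sepConfig_pair_of_wredI'`**: every non-isolated vertex `y ∉ {a₁, a₂, a₃}` has `y ↔ a₁` in
  `G − {a₂, a₃}` or `y ↔ a₂` in `G − {a₁, a₃}`; `conn_sepConfig_pair_of_wredI` (`y = o`),
  `conn_sepConfig_pair_b_of_wredI` (`y = b`);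
* `sepConfig_pair_mem_PD_conn` (the witnessing configuration lies in `PD ∩ {o ∈ C₁}`);
* **`Do_pos_of_wredI`**, **`Do_pos_of_wredMinH`**: `0 < D_o` on the residual at interior weights
  — so `γ = D_o / D ∈ (0, 1]` there, with `D > 0` from `PD_pos_of_int`; **`PDb_pos_of_wredI`**:
  `0 < P(PD, b ∈ U)` likewise.
-/

namespace Summit.Ventures.PercRepro2

open CovForm UnionCluster RECM SepPair

/-! ## `G − A` for nested `A` -/

section Sep

variable {V : Type*} {E : Type*}

/-- Separating fewer vertices opens more edges. -/
lemma sepConfig_mono {ends : E → Sym2 V} {A B : Set V} (hBA : B ⊆ A) :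
    sepConfig ends A ≤ sepConfig ends B := by
  intro e
  by_cases h : sepConfig ends A e = true
  · rw [h, sepConfig_eq_true fun ht => not_mem_touches_of_sepConfig h (touches_mono hBA ht)]
  · rw [Bool.not_eq_true] at h
    rw [h]
    exact Bool.false_le _

/-- A separated vertex is isolated in `G − A`: it is connected only to itself. -/
lemma eq_of_conn_sepConfig_of_mem {ends : E → Sym2 V} {A : Set V} {x y : V} (hx : x ∈ A)
    (h : Conn ends (sepConfig ends A) x y) : y = x := by
  have hmem := mem_of_conn_of_closed (S := {x}) (fun z hz w hzw => ?_) (Set.mem_singleton x) h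
  · exact Set.mem_singleton_iff.1 hmem
  · exfalso
    rw [Set.mem_singleton_iff] at hz
    subst hz
    obtain ⟨_, e, he, hends⟩ := openGraph_adj.1 hzw
    exact not_mem_touches_of_sepConfig he (mem_touches_of_ends hends (Or.inl hx))

/-- **The edge step**: if `x` is in the component `K` of `o` in `G − {a₁, a₂, a₃}` and an edge
joins `x` to `a₁`, then `o ↔ a₁` in `G − {a₂, a₃}`. -/
lemma conn_sepConfig_pair_of_edge {ends : E → Sym2 V} {o a₁ a₂ a₃ x : V}
    (ho : o ∉ ({a₁, a₂, a₃} : Set V)) (h12 : a₁ ≠ a₂) (h13 : a₁ ≠ a₃)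
    (hx : x ∈ cluster ends (sepConfig ends {a₁, a₂, a₃}) o) {e : E} (he : ends e = s(x, a₁)) :
    Conn ends (sepConfig ends {a₂, a₃}) o a₁ := by
  have hxA : x ∉ ({a₁, a₂, a₃} : Set V) := not_mem_of_conn_sepConfig ho hx
  have hsub : ({a₂, a₃} : Set V) ⊆ {a₁, a₂, a₃} := fun z hz => Or.inr hz
  have hox : Conn ends (sepConfig ends {a₂, a₃}) o x := conn_mono (sepConfig_mono hsub) hx
  have hopen : sepConfig ends {a₂, a₃} e = true := by
    refine sepConfig_eq_true fun ht => ?_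
    obtain ⟨z, hz, w, hzw⟩ := ht
    have hmem : z ∈ ends e := by rw [hzw]; exact Sym2.mem_mk_left _ _
    rw [he, Sym2.mem_iff] at hmem
    rcases hmem with rfl | rfl
    · exact hxA (hsub hz)
    · rcases hz with rfl | rfl
      · exact h12 rfl
      · exact h13 rfl
  exact conn_trans hox (conn_of_openAdj ⟨e, hopen, he⟩)

end Sep

/-! ## On the residual `o` reaches a root avoiding the other root and `a₃` -/

namespace WRed

section Residual

variable {V : Type*} {E : Type*} [Fintype E] [DecidableEq V]
variable {ends : E → Sym2 V} {o a₁ a₂ a₃ b : V}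

/-- **On the residual every non-isolated vertex `y` off the three marks `a₁, a₂, a₃` reaches a
root avoiding the other root and `a₃`**: `y ↔ a₁` in `G − {a₂, a₃}` or `y ↔ a₂` in `G − {a₁, a₃}`.
With `K` the component of `y` in `G − {a₁, a₂, a₃}`: either an edge joins `K` to a root, or `K` is
closed under the open adjacency of `G − a₃`, against `y ↔ a₁` there (two-connectivity off `a₃`). -/
theorem conn_sepConfig_pair_of_wredI' (h : WReducedI ends o a₁ a₂ a₃ b)
    (h12 : a₁ ≠ a₂) (h13 : a₁ ≠ a₃) (h23 : a₂ ≠ a₃) (ho1 : o ≠ a₁) (ho2 : o ≠ a₂) (ho3 : o ≠ a₃)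
    (hob : o ≠ b) (hb1 : b ≠ a₁) (hb2 : b ≠ a₂) (hb3 : b ≠ a₃) {y : V} (hy1 : y ≠ a₁)
    (hy2 : y ≠ a₂) (hy3 : y ≠ a₃) (hy : ∃ e, y ∈ ends e ∧ ¬ (ends e).IsDiag) :
    Conn ends (sepConfig ends {a₂, a₃}) y a₁ ∨ Conn ends (sepConfig ends {a₁, a₃}) y a₂ := by
  have hyA : y ∉ ({a₁, a₂, a₃} : Set V) := by
    simp only [Set.mem_insert_iff, Set.mem_singleton_iff, not_or]
    exact ⟨hy1, hy2, hy3⟩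
  have hyA' : y ∉ ({a₂, a₁, a₃} : Set V) := by
    simp only [Set.mem_insert_iff, Set.mem_singleton_iff, not_or]
    exact ⟨hy2, hy1, hy3⟩
  have hperm : ({a₂, a₁, a₃} : Set V) = {a₁, a₂, a₃} := Set.insert_comm _ _ _
  by_cases h1 : ∃ (x : V) (e : E), x ∈ cluster ends (sepConfig ends {a₁, a₂, a₃}) y ∧
      ends e = s(x, a₁)
  · obtain ⟨x, e, hx, he⟩ := h1
    exact Or.inl (conn_sepConfig_pair_of_edge hyA h12 h13 hx he)
  by_cases h2 : ∃ (x : V) (e : E), x ∈ cluster ends (sepConfig ends {a₁, a₂, a₃}) y ∧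
      ends e = s(x, a₂)
  · obtain ⟨x, e, hx, he⟩ := h2
    rw [← hperm] at hx
    exact Or.inr (conn_sepConfig_pair_of_edge hyA' h12.symm h23 hx he)
  exfalso
  -- `y ↔ a₁` in `G − a₃` by two-connectivity off `a₃`
  have hconn : Conn ends (sepConfig ends {a₃}) y a₁ :=
    conn_sepConfig_of_wredI h h12 h13 h23 ho1 ho2 ho3 hob hb1 hb2 hb3 hy3 h13 hy3 h13 hy
      (exists_edge_of_not_isolated h.notIso_a1)
  -- but the component `K` of `y` in `G − {a₁, a₂, a₃}` is closed under the open adjacency of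
  -- `G − a₃`, and `a₁ ∉ K`
  have hK : a₁ ∈ cluster ends (sepConfig ends {a₁, a₂, a₃}) y := by
    refine mem_of_conn_of_closed (S := cluster ends (sepConfig ends {a₁, a₂, a₃}) y)
      (fun x hx z hxz => ?_) (mem_cluster_self _ _ _) hconn
    obtain ⟨hne, e, he, hends⟩ := openGraph_adj.1 hxz
    have hxA : x ∉ ({a₁, a₂, a₃} : Set V) := not_mem_of_conn_sepConfig hyA hx
    have hz3 : z ≠ a₃ := fun hz =>
      not_mem_touches_of_sepConfig he (mem_touches_of_ends hends (Or.inr (hz ▸ rfl)))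
    have hz1 : z ≠ a₁ := fun hz => h1 ⟨x, e, hx, hz ▸ hends⟩
    have hz2 : z ≠ a₂ := fun hz => h2 ⟨x, e, hx, hz ▸ hends⟩
    have hopen : sepConfig ends {a₁, a₂, a₃} e = true := by
      refine sepConfig_eq_true fun ht => ?_
      obtain ⟨w, hw, w', hww'⟩ := ht
      have hmem : w ∈ ends e := by rw [hww']; exact Sym2.mem_mk_left _ _
      rw [hends, Sym2.mem_iff] at hmem
      rcases hmem with rfl | rfl
      · exact hxA hw
      · simp only [Set.mem_insert_iff, Set.mem_singleton_iff] at hw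
        rcases hw with rfl | rfl | rfl
        · exact hz1 rfl
        · exact hz2 rfl
        · exact hz3 rfl
    exact mem_cluster_of_adj hx (openGraph_adj.2 ⟨hne, e, hopen, hends⟩)
  exact not_mem_of_conn_sepConfig hyA hK (Or.inl rfl)

/-- **`o ↔ a₁` in `G − {a₂, a₃}` or `o ↔ a₂` in `G − {a₁, a₃}` on the residual.** -/
theorem conn_sepConfig_pair_of_wredI (h : WReducedI ends o a₁ a₂ a₃ b)
    (h12 : a₁ ≠ a₂) (h13 : a₁ ≠ a₃) (h23 : a₂ ≠ a₃) (ho1 : o ≠ a₁) (ho2 : o ≠ a₂) (ho3 : o ≠ a₃)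
    (hob : o ≠ b) (hb1 : b ≠ a₁) (hb2 : b ≠ a₂) (hb3 : b ≠ a₃) :
    Conn ends (sepConfig ends {a₂, a₃}) o a₁ ∨ Conn ends (sepConfig ends {a₁, a₃}) o a₂ :=
  conn_sepConfig_pair_of_wredI' h h12 h13 h23 ho1 ho2 ho3 hob hb1 hb2 hb3 ho1 ho2 ho3
    (exists_edge_of_not_isolated h.notIso_o)

/-- **`b ↔ a₁` in `G − {a₂, a₃}` or `b ↔ a₂` in `G − {a₁, a₃}` on the residual.** -/
theorem conn_sepConfig_pair_b_of_wredI (h : WReducedI ends o a₁ a₂ a₃ b)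
    (h12 : a₁ ≠ a₂) (h13 : a₁ ≠ a₃) (h23 : a₂ ≠ a₃) (ho1 : o ≠ a₁) (ho2 : o ≠ a₂) (ho3 : o ≠ a₃)
    (hob : o ≠ b) (hb1 : b ≠ a₁) (hb2 : b ≠ a₂) (hb3 : b ≠ a₃) :
    Conn ends (sepConfig ends {a₂, a₃}) b a₁ ∨ Conn ends (sepConfig ends {a₁, a₃}) b a₂ :=
  conn_sepConfig_pair_of_wredI' h h12 h13 h23 ho1 ho2 ho3 hob hb1 hb2 hb3 hb1 hb2 hb3
    (exists_edge_of_not_isolated h.notIso_b)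

end Residual

/-! ## `D_o > 0` -/

section Mass

variable {V : Type*} {E : Type*} [Fintype E] [DecidableEq E] [DecidableEq V] {R : Type*}
  [Field R] [LinearOrder R] [IsStrictOrderedRing R]
variable {ends : E → Sym2 V} {o a₁ a₂ a₃ b : V}

omit [Fintype E] [DecidableEq E] [DecidableEq V] in
/-- `G − {a₂, a₃}` lies in `PD ∩ {o ∈ C₁}` as soon as `o ↔ a₁` there. -/
lemma sepConfig_pair_mem_PD_conn (h12 : a₁ ≠ a₂) (h13 : a₁ ≠ a₃) (h23 : a₂ ≠ a₃)
    (hconn : Conn ends (sepConfig ends {a₂, a₃}) o a₁) :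
    sepConfig ends {a₂, a₃} ∈ PDEvent ends a₁ a₂ a₃ ∩ connEvent ends a₁ o := by
  have h2 : a₂ ∈ ({a₂, a₃} : Set V) := Or.inl rfl
  have h3 : a₃ ∈ ({a₂, a₃} : Set V) := Or.inr rfl
  refine ⟨⟨fun h => ?_, fun h => ?_⟩, conn_symm hconn⟩
  · exact h12 (eq_of_conn_sepConfig_of_mem h2 (conn_symm h))
  · rcases (Set.mem_union _ _ _).1 h with h | h
    · exact h13 (eq_of_conn_sepConfig_of_mem h3 h)
    · exact h23 (eq_of_conn_sepConfig_of_mem h3 h)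

/-- **`D_o = P(PD, o ∈ U) > 0` on the residual at interior weights.** -/
theorem Do_pos_of_wredI {p : E → R} (hp : IsIntVec p) (h : WReducedI ends o a₁ a₂ a₃ b)
    (h12 : a₁ ≠ a₂) (h13 : a₁ ≠ a₃) (h23 : a₂ ≠ a₃) (ho1 : o ≠ a₁) (ho2 : o ≠ a₂) (ho3 : o ≠ a₃)
    (hob : o ≠ b) (hb1 : b ≠ a₁) (hb2 : b ≠ a₂) (hb3 : b ≠ a₃) :
    0 < Do p ends o a₁ a₂ a₃ := by
  unfold Do
  rcases conn_sepConfig_pair_of_wredI h h12 h13 h23 ho1 ho2 ho3 hob hb1 hb2 hb3 with hc | hc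
  · exact add_pos_of_pos_of_nonneg
      (prob_pos_of_int hp ⟨_, sepConfig_pair_mem_PD_conn h12 h13 h23 hc⟩)
      (prob_nonneg hp.isProbVec _)
  · -- the mirror: `PD` is symmetric in the roots
    have hmem : sepConfig ends {a₁, a₃} ∈ PDEvent ends a₁ a₂ a₃ ∩ connEvent ends a₂ o := by
      obtain ⟨⟨hQ, hU⟩, hco⟩ := sepConfig_pair_mem_PD_conn h12.symm h23 h13 hc
      refine ⟨⟨fun h' => hQ (conn_symm h'), fun h' => hU ?_⟩, hco⟩
      rcases (Set.mem_union _ _ _).1 h' with h' | h'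
      · exact (Set.mem_union _ _ _).2 (Or.inr h')
      · exact (Set.mem_union _ _ _).2 (Or.inl h')
    exact add_pos_of_nonneg_of_pos (prob_nonneg hp.isProbVec _) (prob_pos_of_int hp ⟨_, hmem⟩)

/-- **`P(PD, b ∈ U) > 0` on the residual at interior weights** (the same argument at `b`). -/
theorem PDb_pos_of_wredI {p : E → R} (hp : IsIntVec p) (h : WReducedI ends o a₁ a₂ a₃ b)
    (h12 : a₁ ≠ a₂) (h13 : a₁ ≠ a₃) (h23 : a₂ ≠ a₃) (ho1 : o ≠ a₁) (ho2 : o ≠ a₂) (ho3 : o ≠ a₃)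
    (hob : o ≠ b) (hb1 : b ≠ a₁) (hb2 : b ≠ a₂) (hb3 : b ≠ a₃) :
    0 < PDb p ends a₁ a₂ a₃ b := by
  unfold PDb
  rcases conn_sepConfig_pair_b_of_wredI h h12 h13 h23 ho1 ho2 ho3 hob hb1 hb2 hb3 with hc | hc
  · exact add_pos_of_pos_of_nonneg
      (prob_pos_of_int hp ⟨_, sepConfig_pair_mem_PD_conn h12 h13 h23 hc⟩)
      (prob_nonneg hp.isProbVec _)
  · have hmem : sepConfig ends {a₁, a₃} ∈ PDEvent ends a₁ a₂ a₃ ∩ connEvent ends a₂ b := by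
      obtain ⟨⟨hQ, hU⟩, hco⟩ := sepConfig_pair_mem_PD_conn h12.symm h23 h13 hc
      refine ⟨⟨fun h' => hQ (conn_symm h'), fun h' => hU ?_⟩, hco⟩
      rcases (Set.mem_union _ _ _).1 h' with h' | h'
      · exact (Set.mem_union _ _ _).2 (Or.inr h')
      · exact (Set.mem_union _ _ _).2 (Or.inl h')
    exact add_pos_of_nonneg_of_pos (prob_nonneg hp.isProbVec _) (prob_pos_of_int hp ⟨_, hmem⟩)

/-- `D_o > 0` on the class of record at interior weights. -/
theorem Do_pos_of_wredMinH {p : E → R} (hp : IsIntVec p) (h : WReducedMinH ends o a₁ a₂ a₃ b)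
    (h12 : a₁ ≠ a₂) (h13 : a₁ ≠ a₃) (h23 : a₂ ≠ a₃) (ho1 : o ≠ a₁) (ho2 : o ≠ a₂) (ho3 : o ≠ a₃)
    (hob : o ≠ b) (hb1 : b ≠ a₁) (hb2 : b ≠ a₂) (hb3 : b ≠ a₃) :
    0 < Do p ends o a₁ a₂ a₃ :=
  Do_pos_of_wredI hp (wredI_of_wredMinH h) h12 h13 h23 ho1 ho2 ho3 hob hb1 hb2 hb3

end Mass

end WRed

end Summit.Ventures.PercRepro2
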